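import Literature.NumberTheory.EllipticCurves.KuriharaNumber
import Literature.NumberTheory.EllipticCurves.PAdicLFunctionDistributionProofs
import HarnessLib

/-!
# Crux `SelmerRankLB` (stmt-BirchSwinnertonDyer-0131), line `kurihara_order`, stub V1
# `stub_delta_parity` — algebraic lemmas I (reduction mod `p^k`, logarithm families, fibres)

First support file for `SelmerRankSelmerRankLBStubDeltaParity` (the stub: the Mazur–Tate
functional equation kills the Kurihara numbers
`δ_n = Σ_{a ∈ (ℤ/n)ˣ} \overline{[a/n]⁺_f} Π_{ℓ ∣ n} λ_ℓ(a)` of the wrong parity; Kim 2022,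
Prop. 3.16). PURE ALGEBRA, no new definitions (statements are written out in full):

* `\overline{q} = ratModP (p^k) q` is additive / `ℤ`-linear on `p`-integral rationals
  (`‖q‖_p ≤ 1`): `deltaParity_ratModP_add`, `…_intCast_mul`, `…_neg`, `…_mul_sub_sub`, `…_sum`
  (via the tree's `ratModP_eq_toZModPow`: on `ℤ_(p)` it is the ring map `ℤ_(p) → ℤ_p → ℤ/p^k`);
* "logarithm-like" families `Λ ℓ : ZMod ℓ → A`, additive on the reductions of units of `ℤ/m`,
  `ℓ ∣ m` (hypothesis `hΛ`; the stub instantiates `Λ_ℓ = log_ℓ` extended by zero):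
  `Λ(1) = 0`, `Λ(u⁻¹) = −Λ(u)`, `Λ(−1) = 0` when `2 ∈ Aˣ`, the shift of the weights
  `Π_{ℓ∈S} Λ_ℓ(L^{±1} c) = Π (Λ_ℓ(c) ± Λ_ℓ(L))` and their binomial expansion against a sum
  (`deltaParity_sum_mul_prod_add`, `Finset.prod_add`);
* the fibres of `ℤ/m'ℓ → ℤ/m'` (`{b + m'j : j < ℓ}`, `deltaParity_filter_cast_eq_image`, adapted
  from the tree's `filter_castHom_eq_image` for `p^n ∣ p^{n+1}`), the unit criterion and
  Chinese-remainder injectivity for `gcd(m', ℓ) = 1`.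

The norm relation and the vanishing of the incomplete Kurihara sums are in the second support
file `SelmerRankSelmerRankLBStubDeltaParityNormRelation`.

References: B. Mazur, J. Tate, Duke Math. J. 54 (1987), §1; C.-H. Kim, arXiv:2203.12159,
Prop. 3.16; M. Kurihara, Iwasawa 2012 volume (2014), §1.1.
-/

noncomputable section

set_option linter.dupNamespace false

open scoped MatrixGroups ModularForm Classical

open CongruenceSubgroup Literature.NumberTheory.EllipticCurves
  Literature.NumberTheory.EllipticCurves.ModularForms

open Literature.NumberTheory.DiophantineGeometry.Dioph (ratModP)

namespace Summit.BirchSwinnertonDyer.BirchSwinnertonDyer.Theorems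
/-! ### Reduction modulo `p^k` of `p`-integral rationals -/

section RatMod

variable {p : ℕ} [Fact p.Prime] (k : ℕ)

/-- `p`-integral rationals are closed under addition (`‖x + y‖_p ≤ max`). [folklore] -/
theorem deltaParity_norm_add_le {x y : ℚ} (hx : ‖((x : ℚ) : ℚ_[p])‖ ≤ 1)
    (hy : ‖((y : ℚ) : ℚ_[p])‖ ≤ 1) : ‖(((x + y : ℚ)) : ℚ_[p])‖ ≤ 1 := by
  rw [Rat.cast_add]
  exact (Padic.nonarchimedean _ _).trans (max_le hx hy)

/-- `p`-integral rationals are closed under multiplication by integers. [folklore] -/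
theorem deltaParity_norm_intCast_mul_le (z : ℤ) {x : ℚ} (hx : ‖((x : ℚ) : ℚ_[p])‖ ≤ 1) :
    ‖(((z * x : ℚ)) : ℚ_[p])‖ ≤ 1 := by
  rw [Rat.cast_mul, Rat.cast_intCast, norm_mul]
  exact mul_le_one₀ (Padic.norm_int_le_one z) (norm_nonneg _) hx

/-- `p`-integral rationals are closed under negation. [folklore] -/
theorem deltaParity_norm_neg_le {x : ℚ} (hx : ‖((x : ℚ) : ℚ_[p])‖ ≤ 1) :
    ‖(((-x : ℚ)) : ℚ_[p])‖ ≤ 1 := by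
  rwa [Rat.cast_neg, norm_neg]

/-- `p`-integral rationals are closed under finite sums. [folklore] -/
theorem deltaParity_norm_sum_le {ι : Type*} (s : Finset ι) {g : ι → ℚ}
    (hg : ∀ i ∈ s, ‖((g i : ℚ) : ℚ_[p])‖ ≤ 1) : ‖(((∑ i ∈ s, g i : ℚ)) : ℚ_[p])‖ ≤ 1 := by
  induction s using Finset.induction_on with
  | empty => simp
  | insert a s ha ih =>
    rw [Finset.sum_insert ha]
    exact deltaParity_norm_add_le (hg a (Finset.mem_insert_self a s))
      (ih fun i hi ↦ hg i (Finset.mem_insert_of_mem hi))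

/-- **`\overline{x + y} = \overline{x} + \overline{y}`** for `p`-integral rationals: the reduction
`ratModP (p^k)` is the ring map `ℤ_(p) → ℤ_p → ℤ/p^k` there (`ratModP_eq_toZModPow`). [folklore] -/
theorem deltaParity_ratModP_add {x y : ℚ} (hx : ‖((x : ℚ) : ℚ_[p])‖ ≤ 1)
    (hy : ‖((y : ℚ) : ℚ_[p])‖ ≤ 1) :
    ratModP (p ^ k) (x + y) = ratModP (p ^ k) x + ratModP (p ^ k) y := by
  rw [ratModP_eq_toZModPow p k (not_dvd_den_of_norm_ratCast_le_one hx),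
    ratModP_eq_toZModPow p k (not_dvd_den_of_norm_ratCast_le_one hy),
    ratModP_eq_toZModPow p k
      (not_dvd_den_of_norm_ratCast_le_one (deltaParity_norm_add_le hx hy)), ← map_add]
  congr 1

/-- **`\overline{z x} = z \overline{x}`** for `z ∈ ℤ` and a `p`-integral rational `x`. [folklore] -/
theorem deltaParity_ratModP_intCast_mul (z : ℤ) {x : ℚ} (hx : ‖((x : ℚ) : ℚ_[p])‖ ≤ 1) :
    ratModP (p ^ k) (z * x) = z * ratModP (p ^ k) x := by
  rw [ratModP_eq_toZModPow p k (not_dvd_den_of_norm_ratCast_le_one hx),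
    ratModP_eq_toZModPow p k
      (not_dvd_den_of_norm_ratCast_le_one (deltaParity_norm_intCast_mul_le z hx)),
    ← map_intCast (PadicInt.toZModPow k) z, ← map_mul]
  congr 1

/-- `\overline{-x} = -\overline{x}` for a `p`-integral rational `x`. [folklore] -/
theorem deltaParity_ratModP_neg {x : ℚ} (hx : ‖((x : ℚ) : ℚ_[p])‖ ≤ 1) :
    ratModP (p ^ k) (-x) = -ratModP (p ^ k) x := by
  have h := deltaParity_ratModP_intCast_mul k (-1) hx
  push_cast at h
  rwa [neg_one_mul, neg_one_mul] at h

/-- `\overline{z x - y - w} = z \overline{x} - \overline{y} - \overline{w}` for `p`-integral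
rationals (the shape of the norm relation). [folklore] -/
theorem deltaParity_ratModP_mul_sub_sub (z : ℤ) {x y w : ℚ} (hx : ‖((x : ℚ) : ℚ_[p])‖ ≤ 1)
    (hy : ‖((y : ℚ) : ℚ_[p])‖ ≤ 1) (hw : ‖((w : ℚ) : ℚ_[p])‖ ≤ 1) :
    ratModP (p ^ k) (z * x - y - w) =
      z * ratModP (p ^ k) x - ratModP (p ^ k) y - ratModP (p ^ k) w := by
  have hzx := deltaParity_norm_intCast_mul_le z hx
  have hny := deltaParity_norm_neg_le hy
  have hnw := deltaParity_norm_neg_le hw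
  rw [sub_eq_add_neg, sub_eq_add_neg,
    deltaParity_ratModP_add k (deltaParity_norm_add_le hzx hny) hnw,
    deltaParity_ratModP_add k hzx hny, deltaParity_ratModP_neg k hy,
    deltaParity_ratModP_neg k hw, deltaParity_ratModP_intCast_mul k z hx]
  ring

/-- `\overline{Σ xᵢ} = Σ \overline{xᵢ}` for `p`-integral rationals. [folklore] -/
theorem deltaParity_ratModP_sum {ι : Type*} (s : Finset ι) {g : ι → ℚ}
    (hg : ∀ i ∈ s, ‖((g i : ℚ) : ℚ_[p])‖ ≤ 1) :
    ratModP (p ^ k) (∑ i ∈ s, g i) = ∑ i ∈ s, ratModP (p ^ k) (g i) := by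
  induction s using Finset.induction_on with
  | empty => simp
  | insert a s ha ih =>
    rw [Finset.sum_insert ha, Finset.sum_insert ha,
      deltaParity_ratModP_add k (hg a (Finset.mem_insert_self a s))
        (deltaParity_norm_sum_le s fun i hi ↦ hg i (Finset.mem_insert_of_mem hi)),
      ih fun i hi ↦ hg i (Finset.mem_insert_of_mem hi)]

end RatMod

/-! ### Logarithm-like families `Λ_ℓ : ℤ/ℓ → A` -/

section Lambda

variable {A : Type*} [CommRing A] (Λ : (ℓ : ℕ) → ZMod ℓ → A)
  (hΛ : ∀ {ℓ m : ℕ}, ℓ ∣ m → ∀ u v : (ZMod m)ˣ,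
    Λ ℓ ((↑(u * v) : ZMod m).cast) = Λ ℓ ((u : ZMod m).cast) + Λ ℓ ((v : ZMod m).cast))

include hΛ

/-- An additive-on-units family vanishes at `1`. [folklore] -/
theorem deltaParity_Λ_one {ℓ m : ℕ} (h : ℓ ∣ m) :
    Λ ℓ ((↑(1 : (ZMod m)ˣ) : ZMod m).cast) = 0 := by
  have h1 := hΛ h 1 1
  rwa [one_mul, left_eq_add] at h1

/-- An additive-on-units family is odd under inversion. [folklore] -/
theorem deltaParity_Λ_inv {ℓ m : ℕ} (h : ℓ ∣ m) (u : (ZMod m)ˣ) :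
    Λ ℓ ((↑u⁻¹ : ZMod m).cast) = -Λ ℓ ((u : ZMod m).cast) := by
  have h1 := hΛ h u⁻¹ u
  rw [inv_mul_cancel, deltaParity_Λ_one Λ hΛ h] at h1
  exact eq_neg_of_add_eq_zero_left h1.symm

/-- **`Λ_ℓ(-1) = 0` when `2` is invertible in `A`** (`2 Λ(-1) = Λ(1) = 0`): the discrete
logarithms of `-1` modulo `p^k`, `p` odd, vanish. [folklore] -/
theorem deltaParity_Λ_neg_one (h2 : IsUnit (2 : A)) {ℓ m : ℕ} (h : ℓ ∣ m) :
    Λ ℓ ((↑(-1 : (ZMod m)ˣ) : ZMod m).cast) = 0 := by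
  have h1 := hΛ h (-1) (-1)
  rw [neg_one_mul, neg_neg, deltaParity_Λ_one Λ hΛ h, ← two_mul] at h1
  exact (h2.mul_right_eq_zero).mp h1.symm

omit hΛ in
/-- Transitivity of the reductions `ℤ/m → ℤ/m' → ℤ/ℓ` (`ZMod.castHom_comp`). [folklore] -/
theorem deltaParity_cast_cast {ℓ m' m : ℕ} (h₁ : ℓ ∣ m') (h₂ : m' ∣ m) (a : ZMod m) :
    ((a.cast : ZMod m').cast : ZMod ℓ) = (a.cast : ZMod ℓ) := by
  have h := RingHom.congr_fun (ZMod.castHom_comp h₁ h₂) a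
  rwa [RingHom.comp_apply, ZMod.castHom_apply, ZMod.castHom_apply, ZMod.castHom_apply] at h

omit hΛ in
/-- The weight `Π_{ℓ ∈ S} Λ_ℓ(a mod ℓ)` only depends on `a mod m'` when every `ℓ ∈ S` divides
`m' ∣ m`. [folklore] -/
theorem deltaParity_prod_cast_cast {m' m : ℕ} (h : m' ∣ m) {S : Finset ℕ}
    (hS : ∀ ℓ ∈ S, ℓ ∣ m') (a : ZMod m) :
    ∏ ℓ ∈ S, Λ ℓ (a.cast : ZMod ℓ) = ∏ ℓ ∈ S, Λ ℓ ((a.cast : ZMod m').cast : ZMod ℓ) :=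
  Finset.prod_congr rfl fun ℓ hℓ ↦ by rw [deltaParity_cast_cast (hS ℓ hℓ) h]

/-- Shift of the weight by a unit `L`: `Π_{ℓ∈S} Λ_ℓ(L c) = Π_{ℓ∈S} (Λ_ℓ(c) + Λ_ℓ(L))`. [folklore] -/
theorem deltaParity_prod_cast_mul {m : ℕ} {S : Finset ℕ} (hS : ∀ ℓ ∈ S, ℓ ∣ m)
    (L c : (ZMod m)ˣ) :
    ∏ ℓ ∈ S, Λ ℓ ((↑(L * c) : ZMod m).cast) =
      ∏ ℓ ∈ S, (Λ ℓ ((c : ZMod m).cast) + Λ ℓ ((L : ZMod m).cast)) :=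
  Finset.prod_congr rfl fun ℓ hℓ ↦ by rw [hΛ (hS ℓ hℓ), add_comm]

/-- Shift of the weight by `L⁻¹`: `Π_{ℓ∈S} Λ_ℓ(L⁻¹ c) = Π_{ℓ∈S} (Λ_ℓ(c) - Λ_ℓ(L))`. [folklore] -/
theorem deltaParity_prod_cast_inv_mul {m : ℕ} {S : Finset ℕ} (hS : ∀ ℓ ∈ S, ℓ ∣ m)
    (L c : (ZMod m)ˣ) :
    ∏ ℓ ∈ S, Λ ℓ ((↑(L⁻¹ * c) : ZMod m).cast) =
      ∏ ℓ ∈ S, (Λ ℓ ((c : ZMod m).cast) + -Λ ℓ ((L : ZMod m).cast)) :=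
  Finset.prod_congr rfl fun ℓ hℓ ↦ by
    rw [hΛ (hS ℓ hℓ), deltaParity_Λ_inv Λ hΛ (hS ℓ hℓ), add_comm]

omit hΛ in
/-- **Binomial expansion of a shifted weight against a sum**:
`Σ_c s(c) Π_{ℓ∈S} (Λ_ℓ(c) + e_ℓ) = Σ_{T ⊆ S} (Π_{ℓ ∈ S∖T} e_ℓ) Σ_c s(c) Π_{ℓ∈T} Λ_ℓ(c)`
(`Finset.prod_add`). [folklore] -/
theorem deltaParity_sum_mul_prod_add {m : ℕ} [NeZero m] (s : (ZMod m)ˣ → A) (S : Finset ℕ)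
    (e : ℕ → A) :
    ∑ c : (ZMod m)ˣ, s c * ∏ ℓ ∈ S, (Λ ℓ ((c : ZMod m).cast) + e ℓ) =
      ∑ T ∈ S.powerset, (∏ ℓ ∈ S \ T, e ℓ) *
        ∑ c : (ZMod m)ˣ, s c * ∏ ℓ ∈ T, Λ ℓ ((c : ZMod m).cast) := by
  simp_rw [Finset.prod_add, Finset.mul_sum]
  rw [Finset.sum_comm]
  refine Finset.sum_congr rfl fun T _ ↦ Finset.sum_congr rfl fun c _ ↦ ?_
  ring

end Lambda

/-! ### The fibres of `ℤ/m'ℓ → ℤ/m'` -/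

section Fibre

variable {m' ℓ : ℕ} [NeZero m'] [NeZero ℓ]

/-- The classes of `b + m' j`, `j < ℓ`, in `ℤ/m'ℓ` have `val = b.val + m' j`. [folklore] -/
theorem deltaParity_val_classLift (b : ZMod m') (j : Fin ℓ) :
    (((b.val + m' * (j : ℕ) : ℕ) : ZMod (m' * ℓ)).val = b.val + m' * (j : ℕ)) := by
  refine ZMod.val_natCast_of_lt ?_
  have hℓ : 0 < ℓ := Nat.pos_of_ne_zero (NeZero.ne ℓ)
  obtain ⟨l, rfl⟩ : ∃ l, ℓ = l + 1 := ⟨ℓ - 1, by omega⟩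
  have h1 := ZMod.val_lt b
  have h2 : m' * (j : ℕ) ≤ m' * l := Nat.mul_le_mul_left _ (by omega)
  have h3 : m' * (l + 1) = m' * l + m' := by ring
  omega

/-- **The fibre of `b ∈ ℤ/m'` in `ℤ/m'ℓ` is `{b + m' j : j < ℓ}`.** [folklore] -/
theorem deltaParity_filter_cast_eq_image (b : ZMod m') :
    Finset.univ.filter (fun a : ZMod (m' * ℓ) ↦ (a.cast : ZMod m') = b) =
      Finset.univ.image (fun j : Fin ℓ ↦ ((b.val + m' * (j : ℕ) : ℕ) : ZMod (m' * ℓ))) := by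
  have hm' : 0 < m' := Nat.pos_of_ne_zero (NeZero.ne m')
  ext a
  simp only [Finset.mem_filter, Finset.mem_univ, true_and, Finset.mem_image]
  constructor
  · intro hb
    have hba : a.val % m' = b.val := by
      have h := congr_arg ZMod.val hb
      rwa [ZMod.cast_eq_val, ZMod.val_natCast] at h
    have hlt : a.val / m' < ℓ := by
      rw [Nat.div_lt_iff_lt_mul hm']
      calc a.val < m' * ℓ := ZMod.val_lt a
        _ = ℓ * m' := mul_comm _ _
    refine ⟨⟨a.val / m', hlt⟩, ?_⟩
    dsimp only
    rw [← hba, Nat.mod_add_div, ZMod.natCast_zmod_val]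
  · rintro ⟨j, rfl⟩
    rw [ZMod.cast_natCast (dvd_mul_right m' ℓ), Nat.cast_add, Nat.cast_mul, ZMod.natCast_self,
      zero_mul, add_zero, ZMod.natCast_zmod_val]

/-- A sum over the fibre of `b` is the sum over `j < ℓ` of the classes `b + m' j`. [folklore] -/
theorem deltaParity_sum_filter_cast_eq {M : Type*} [AddCommMonoid M] (b : ZMod m')
    (F : ZMod (m' * ℓ) → M) :
    ∑ a ∈ Finset.univ.filter (fun a : ZMod (m' * ℓ) ↦ (a.cast : ZMod m') = b), F a =
      ∑ j : Fin ℓ, F ((b.val + m' * (j : ℕ) : ℕ) : ZMod (m' * ℓ)) := by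
  have hinj : Function.Injective
      (fun j : Fin ℓ ↦ ((b.val + m' * (j : ℕ) : ℕ) : ZMod (m' * ℓ))) := by
    intro j j' h
    have hv := congr_arg ZMod.val h
    simp only [deltaParity_val_classLift] at hv
    exact Fin.ext (Nat.eq_of_mul_eq_mul_left (Nat.pos_of_ne_zero (NeZero.ne m')) (by omega))
  rw [deltaParity_filter_cast_eq_image, Finset.sum_image fun j _ j' _ h ↦ hinj h]

/-- Units of `ℤ/m'ℓ` are detected on the two reductions (`gcd(a, m'ℓ) = 1` iff
`gcd(a, m') = gcd(a, ℓ) = 1`). [folklore] -/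
theorem deltaParity_isUnit_of_cast (a : ZMod (m' * ℓ))
    (h₁ : IsUnit (a.cast : ZMod m')) (h₂ : IsUnit (a.cast : ZMod ℓ)) : IsUnit a := by
  rw [ZMod.cast_eq_val, ZMod.isUnit_iff_coprime] at h₁ h₂
  rw [← ZMod.natCast_zmod_val a, ZMod.isUnit_iff_coprime, Nat.coprime_mul_iff_right]
  exact ⟨h₁, h₂⟩

/-- Chinese remainder injectivity: a class of `ℤ/m'ℓ`, `gcd(m', ℓ) = 1`, is determined by its
reductions mod `m'` and mod `ℓ`. [folklore] -/
theorem deltaParity_eq_of_cast_eq (hcop : ℓ.Coprime m') (a a' : ZMod (m' * ℓ))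
    (h₁ : (a.cast : ZMod m') = a'.cast) (h₂ : (a.cast : ZMod ℓ) = a'.cast) : a = a' := by
  obtain ⟨d, rfl⟩ : ∃ d, a = a' + d := ⟨a - a', by ring⟩
  rw [ZMod.cast_add (dvd_mul_right m' ℓ), add_eq_left, ZMod.cast_eq_val,
    ZMod.natCast_eq_zero_iff] at h₁
  rw [ZMod.cast_add (dvd_mul_left ℓ m'), add_eq_left, ZMod.cast_eq_val,
    ZMod.natCast_eq_zero_iff] at h₂
  rw [add_eq_left, ← ZMod.natCast_zmod_val d, ZMod.natCast_eq_zero_iff]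
  exact Nat.Coprime.mul_dvd_of_dvd_of_dvd hcop.symm h₁ h₂

end Fibre

/-! ### Registered sub-goal of this support file -/

/-- **Registered sub-goal `stub_delta_parity_ratModP_sum` (support file I of stub V1
`stub_delta_parity`)**: the reduction `\overline{q} = ratModP (p^k) q` is additive over finite
sums of `p`-integral rationals — the form in which `\overline{·}` is applied to the norm relation
and to the Kurihara sums (closed restatement of `deltaParity_ratModP_sum`). [folklore] -/
theorem stub_delta_parity_ratModP_sum :
    ∀ (p : ℕ) [Fact p.Prime] (k : ℕ) (ι : Type) (s : Finset ι) (g : ι → ℚ),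
      (∀ i ∈ s, ‖((g i : ℚ) : ℚ_[p])‖ ≤ 1) →
      Literature.NumberTheory.DiophantineGeometry.Dioph.ratModP (p ^ k) (∑ i ∈ s, g i) =
        ∑ i ∈ s, Literature.NumberTheory.DiophantineGeometry.Dioph.ratModP (p ^ k) (g i) :=
  fun _ _ k _ s _ hg ↦ deltaParity_ratModP_sum k s hg

end Summit.BirchSwinnertonDyer.BirchSwinnertonDyer.Theorems

end
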